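import Literature.AlgebraicGeometry.HodgeTheory.ProjectiveModelDiagonalSymmetry
import Literature.AlgebraicGeometry.HodgeTheory.FermatEigenlineHodgeTypesViaResidues
import Literature.Geometry.Kaehler.SurfaceHolomorphicTwoFormRatio
import HarnessLib

/-!
# Holomorphic models of the Fermat surface: the affine volume forms and the ratio functions of a `(2,0)`-form

Family `hodge`, layer `Literature/AlgebraicGeometry/HodgeTheory`. PROOF FILE (theorems only; no
definition, no named fact — D-0026) on the path of the analytic leaf `hmodel` of
`AokiShioda1983_eigenline_le_neronSeveri_holds_of_modelEigenforms`
(`FermatSurfaceEigenformsOnModels`). Data: a complex surface `M` charted on `E` (`dim_ℂ E = 2`)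
and a topological embedding `ψ : M → ℙ(ℂ⁴)` onto the Fermat surface `V(F₀)`,
`F₀ = x₀ᵐ + x₁ᵐ + x₂ᵐ + x₃ᵐ`, with holomorphic affine coordinates; on the affine piece
`M_k = ψ⁻¹{x_k ≠ 0}` the **affine volume form** is the fixed-index residue formula
`ω_k(x) = det(N_k, Z̃_k x, dZ̃_k(x) ·)` (`residueFormula ψ F₀ 1 k k`, normal index `k`, which is
admissible on all of `M_k` since `∂_kF₀(Z̃_k x) = m`) — in print `± dy_a ∧ dy_b / (m y_c^{m-1})`,
the nowhere-vanishing holomorphic `2`-form `Res_{U_k}(Ω/F₀)` of the affine Fermat surface.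
For a smooth closed `2`-form `η` of type `(2,0)` and a complex frame `e` of `E` the **ratio
function** is `f_k = η(e)/ω_k(e)` on `M_k`. Proved here:

* `eval_pderiv_fermatPolynomial_projLift_self`, `fermat_jacobian` — admissibility of the normal
  index `k` on `M_k`, the Jacobian condition;
* `fermatVolumeForm_apply_ne_zero`, `exists_analyticGerm_fermatVolumeForm` — `ω_k` is non-zero
  on every frame and holomorphic in charts at the points of `M_k`
  (`residueFormula_one_ne_zero`, `exists_analyticGerm_residueFormula`);
* `mdifferentiableAt_fermatRatio`, `eq_fermatRatio_smul` — **`f_k` is holomorphic on `M_k` and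
  `η = f_k · ω_k` there** (`mdifferentiableAt_twoFormRatio`, `topForm_eq_ratio_smul`);
* `pullback_fermatVolumeForm` — for a holomorphic self-map `Φ` over `[x] ↦ [a • x]`,
  **`Φ^* ω_k = (∏_j a_j/a_k) ω_k` on `M_k`** (`pullback_residueFormula_one_symm`; the normal
  vector `N_k = e_k/m` is unchanged by the scaling `a/a_k`, whose `k`-th entry is `1`);
* `fermatRatio_symm` — hence for a `χ`-EIGENFORM `η` (`Φ^*η = χ η`):
  `f_k(Φ x) · ∏_j (a_j/a_k) = χ · f_k(x)` on `M_k`;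
* `fermatRatio_zero_mul_zpow_eq_one` — the transition on `M₀ ∩ M₁`:
  `f₀(x) · (x₀/x₁)^{m-4} = f₁(x)` (the cocycle of `K = 𝒪(m − 4)`, `residueFormula_one_eq_zpow_smul`).

In print: Shioda 1979 §1 (1.7) — the `μₘ⁴`-character of the holomorphic volume form of the
affine Fermat surface and of its holomorphic multiples.

## References

* [Shioda1979HodgeFermat] T. Shioda, The Hodge conjecture for Fermat varieties, Math. Ann. 245
  (1979) 175–184, §1 (1.7).
* [VoisinHodgeII2003] C. Voisin, Hodge Theory and Complex Algebraic Geometry II (2003), §6.1.3.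
* [Hartshorne1977] R. Hartshorne, Algebraic Geometry (1977), II Example 8.20.3.
-/

noncomputable section

open scoped Manifold ContDiff Topology LinearAlgebra.Projectivization
open Set Filter Projectivization

namespace Literature.AlgebraicGeometry.HodgeTheory

open Literature.AlgebraicGeometry.Motives Literature.NumberTheory.Transcendental Literature.Geometry.Kaehler

/-! ### The Jacobian of the Fermat form on the affine pieces -/

section Jacobian

variable {n m : ℕ} {M : Type*} (ψ : M → ℙ ℂ (Fin (n + 2) → ℂ))

/-- `∂_kF₀(Z̃_k x) = m` for the Fermat form: the normal index `k` is admissible on all of `M_k`.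
[cite: Shioda1979HodgeFermat, §1] -/
theorem eval_pderiv_fermatPolynomial_projLift_self (k : Fin (n + 2)) (x : M) :
    MvPolynomial.eval (projLift ψ k x) (MvPolynomial.pderiv k (fermatPolynomial ℂ n m)) = m := by
  rw [eval_pderiv_fermatPolynomial, projLift_apply_self, one_pow, mul_one]

/-- `∂_kF₀(Z̃_k x) ≠ 0` for `m ≠ 0`. [cite: Shioda1979HodgeFermat, §1] -/
theorem eval_pderiv_fermatPolynomial_projLift_self_ne_zero [NeZero m] (k : Fin (n + 2)) (x : M) :
    MvPolynomial.eval (projLift ψ k x) (MvPolynomial.pderiv k (fermatPolynomial ℂ n m)) ≠ 0 := by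
  rw [eval_pderiv_fermatPolynomial_projLift_self]
  exact Nat.cast_ne_zero.mpr (NeZero.ne m)

/-- The Jacobian condition for the Fermat form in the shape consumed by the residue files.
[cite: Shioda1979HodgeFermat, §1] -/
theorem fermat_jacobian [NeZero m] :
    ∀ z : Fin (n + 2) → ℂ, z ≠ 0 → MvPolynomial.eval z (fermatPolynomial ℂ n m) = 0 →
      ∃ j, MvPolynomial.eval z (MvPolynomial.pderiv j (fermatPolynomial ℂ n m)) ≠ 0 :=
  fun _ hz _ ↦ exists_eval_pderiv_fermatPolynomial_ne_zero NeZero.one_le hz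

end Jacobian

section Surface

variable {m : ℕ} {E : Type*} [NormedAddCommGroup E] [NormedSpace ℂ E] [FiniteDimensional ℂ E]
  {M : Type*} [TopologicalSpace M] [ChartedSpace E M] [IsManifold 𝓘(ℂ, E) ω M]
  {ψ : M → ℙ ℂ (Fin (2 + 2) → ℂ)}

/-! ### The affine volume forms `ω_k` -/

/-- **`ω_k(x) ≠ 0` on `M_k`** (`residueFormula_one_ne_zero` with the admissible normal index `k`).
[cite: VoisinHodgeII2003, §6.1.3] -/
theorem fermatVolumeForm_ne_zero [NeZero m] (hψ : Topology.IsEmbedding ψ)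
    (hrange : Set.range ψ = projZeroLocus {fermatPolynomial ℂ 2 m}) (hhol : HasHolomorphicCoords E ψ)
    (h2 : Module.finrank ℂ E = 2) {k : Fin (2 + 2)} {x : M} (hx : x ∈ liftDomain ψ k) :
    residueFormula (E := E) ψ (fermatPolynomial ℂ 2 m) 1 k k x ≠ 0 :=
  residueFormula_one_ne_zero ψ (isHomogeneous_fermatPolynomial 2 m) hψ hrange.le fermat_jacobian
    hhol h2 hx (eval_pderiv_fermatPolynomial_projLift_self_ne_zero ψ k x)

/-- **`ω_k(x)(e) ≠ 0` on `M_k` for every complex frame `e` of `E`** (a non-zero top-degree form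
is non-zero on every basis). [cite: VoisinHodgeII2003, §6.1.3] -/
theorem fermatVolumeForm_apply_ne_zero [NeZero m] (hψ : Topology.IsEmbedding ψ)
    (hrange : Set.range ψ = projZeroLocus {fermatPolynomial ℂ 2 m}) (hhol : HasHolomorphicCoords E ψ)
    (h2 : Module.finrank ℂ E = 2) {e : Fin 2 → E} (he : LinearIndependent ℂ e) {k : Fin (2 + 2)}
    {x : M} (hx : x ∈ liftDomain ψ k) :
    residueFormula (E := E) ψ (fermatPolynomial ℂ 2 m) 1 k k x e ≠ 0 := by
  have hcard : Fintype.card (Fin 2) = Module.finrank ℂ E := by simp [h2]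
  have hb := coe_basisOfLinearIndependentOfCardEqFinrank he hcard
  have h := apply_ne_zero_of_ne_zero _ (basisOfLinearIndependentOfCardEqFinrank he hcard)
    (fermatVolumeForm_ne_zero hψ hrange hhol h2 hx)
  rwa [hb] at h

/-- **`ω_k` is holomorphic in charts at the points of `M_k`**: an analytic germ representing
a form `ω_k` given by `residueFormula ψ F₀ 1 k k` in the chart at `x₀ ∈ M_k`.
[cite: VoisinHodgeII2003, §6.1.1 and §6.1.3] -/
theorem exists_analyticGerm_fermatVolumeForm [NeZero m] [IsManifold 𝓘(ℝ, E) ∞ M]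
    (hψ : Continuous ψ) (hhol : HasHolomorphicCoords E ψ) {k : Fin (2 + 2)} {x₀ : M}
    (hx₀ : x₀ ∈ liftDomain ψ k) {ω₀ : MForm 𝓘(ℝ, E) M ℂ 2}
    (hω₀ : ∀ x, ω₀ x = (show E [⋀^Fin 2]→L[ℝ] ℂ from
      (residueFormula (E := E) ψ (fermatPolynomial ℂ 2 m) 1 k k x).restrictScalars ℝ)) :
    ∃ g : E → E [⋀^Fin 2]→L[ℂ] ℂ, AnalyticAt ℂ g (extChartAt 𝓘(ℝ, E) x₀ x₀) ∧
      ω₀.inChart x₀ =ᶠ[𝓝 (extChartAt 𝓘(ℝ, E) x₀ x₀)] fun y ↦ (g y).restrictScalars ℝ :=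
  exists_analyticGerm_residueFormula ψ hψ hhol 1 hx₀
    (eval_pderiv_fermatPolynomial_projLift_self_ne_zero ψ k x₀) hω₀

/-! ### The ratio function `f_k = η(e)/ω_k(e)` of a closed `(2,0)`-form -/

/-- **The ratio function is holomorphic on `M_k`.** For `η` a smooth closed `2`-form of type
`(2,0)`, `e` a complex frame of `E` and `f_k(x) = η(x)(e)/ω_k(x)(e)`, `f_k` is complex
differentiable at every point of `M_k` (`mdifferentiableAt_twoFormRatio`: `ω_k` has `ℂ`-bilinear
values, is holomorphic in charts and non-zero on `e` near `x₀`). In print: the quotient of a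
holomorphic `2`-form by the nowhere-vanishing residue form of the affine piece is a holomorphic
function. [cite: Shioda1979HodgeFermat, §1 (1.7)] [cite: VoisinHodgeII2003, §6.1.3] -/
theorem mdifferentiableAt_fermatRatio [NeZero m] [IsManifold 𝓘(ℝ, E) ∞ M]
    (hψ : Topology.IsEmbedding ψ) (hrange : Set.range ψ = projZeroLocus {fermatPolynomial ℂ 2 m})
    (hhol : HasHolomorphicCoords E ψ) (h2 : Module.finrank ℂ E = 2) {e : Fin 2 → E}
    (he : LinearIndependent ℂ e) {η : MForm 𝓘(ℝ, E) M ℂ 2} (hs : IsSmoothForm η)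
    (hc : IsClosedForm η) (ht : IsOfType 2 0 η) {k : Fin (2 + 2)} {ω₀ : MForm 𝓘(ℝ, E) M ℂ 2}
    (hω₀ : ∀ x, ω₀ x = (show E [⋀^Fin 2]→L[ℝ] ℂ from
      (residueFormula (E := E) ψ (fermatPolynomial ℂ 2 m) 1 k k x).restrictScalars ℝ))
    {f : M → ℂ} (hf : ∀ x, f x = η x e / ω₀ x e) {x₀ : M} (hx₀ : x₀ ∈ liftDomain ψ k) :
    MDifferentiableAt 𝓘(ℂ, E) 𝓘(ℂ, ℂ) f x₀ := by
  have hfun : f = fun x ↦ (η x : E [⋀^Fin 2]→L[ℝ] ℂ) e / (ω₀ x : E [⋀^Fin 2]→L[ℝ] ℂ) e :=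
    funext hf
  rw [hfun]
  refine mdifferentiableAt_twoFormRatio h2 hs hc ht he (fun x ↦ ⟨_, hω₀ x⟩)
    (exists_analyticGerm_fermatVolumeForm hψ.continuous hhol hx₀ hω₀) ?_
  filter_upwards [(isOpen_liftDomain ψ hψ.continuous k).mem_nhds hx₀] with x hx
  rw [hω₀ x]
  exact fermatVolumeForm_apply_ne_zero hψ hrange hhol h2 he hx

/-- **`η = f_k · ω_k` on `M_k`** (pointwise; `topForm_eq_ratio_smul`).
[cite: Shioda1979HodgeFermat, §1 (1.7)] [cite: VoisinHodgeI2002, §2.3.1] -/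
theorem eq_fermatRatio_smul [NeZero m] (hψ : Topology.IsEmbedding ψ)
    (hrange : Set.range ψ = projZeroLocus {fermatPolynomial ℂ 2 m}) (hhol : HasHolomorphicCoords E ψ)
    (h2 : Module.finrank ℂ E = 2) {e : Fin 2 → E} (he : LinearIndependent ℂ e)
    {η : MForm 𝓘(ℝ, E) M ℂ 2} (ht : IsOfType 2 0 η) {k : Fin (2 + 2)} {ω₀ : MForm 𝓘(ℝ, E) M ℂ 2}
    (hω₀ : ∀ x, ω₀ x = (show E [⋀^Fin 2]→L[ℝ] ℂ from
      (residueFormula (E := E) ψ (fermatPolynomial ℂ 2 m) 1 k k x).restrictScalars ℝ))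
    {f : M → ℂ} (hf : ∀ x, f x = η x e / ω₀ x e) {x : M} (hx : x ∈ liftDomain ψ k) :
    η x = f x • ω₀ x := by
  have hcard : Fintype.card (Fin 2) = Module.finrank ℂ E := by simp [h2]
  set b := basisOfLinearIndependentOfCardEqFinrank he hcard with hbdef
  have hb : (b : Fin 2 → E) = e := coe_basisOfLinearIndependentOfCardEqFinrank he hcard
  have hne : (ω₀ x : E [⋀^Fin 2]→L[ℝ] ℂ) b ≠ 0 := by
    rw [hb, hω₀ x]
    exact fermatVolumeForm_apply_ne_zero hψ hrange hhol h2 he hx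
  have key := topForm_eq_ratio_smul ht b (hω₀ x) hne
  rw [hb] at key
  rw [hf x]
  exact key

/-! ### The volume form and the ratio under a diagonal symmetry -/

omit [FiniteDimensional ℂ E] [TopologicalSpace M] [ChartedSpace E M] [IsManifold 𝓘(ℂ, E) ω M] in
/-- The normal vector `N_k = e_k/m` of the Fermat form is unchanged by the scaling `a/a_k`
(whose `k`-th entry is `1`). [folklore] -/
theorem normalVec_fermat_diag (a : Fin (2 + 2) → ℂˣ) (k : Fin (2 + 2)) (x : M) :
    normalVec (fermatPolynomial ℂ 2 m) ((fun j ↦ ((a j : ℂ) / (a k : ℂ))) * projLift ψ k x) k =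
      (fun j ↦ ((a j : ℂ) / (a k : ℂ))) * normalVec (fermatPolynomial ℂ 2 m) (projLift ψ k x) k := by
  have hak : ((a k : ℂ)) ≠ 0 := (a k).ne_zero
  have hδk : (fun j ↦ ((a j : ℂ) / (a k : ℂ))) k = 1 := div_self hak
  simp only [normalVec, eval_pderiv_fermatPolynomial, Pi.mul_apply, projLift_apply_self, hδk,
    one_mul, one_pow]
  funext j
  by_cases hj : j = k
  · subst hj
    simp
  · simp [hj]

variable {Φ : M → M} {a : Fin (2 + 2) → ℂˣ}
  (hΦ : ∀ x, ψ (Φ x) = Projectivization.mk ℂ (a • (ψ x).rep)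
    ((smul_ne_zero_iff_ne a).mpr (Projectivization.rep_nonzero _)))

omit [FiniteDimensional ℂ E] [IsManifold 𝓘(ℂ, E) ω M] in
include hΦ in
/-- **`Φ^* ω_k = (∏_j a_j/a_k) • ω_k` on `M_k`** for a holomorphic self-map `Φ` over
`[x] ↦ [a • x]`: the character of the holomorphic volume form of the affine Fermat surface
(`pullback_residueFormula_one_symm`). [cite: Shioda1979HodgeFermat, §1 (1.7)] -/
theorem pullback_fermatVolumeForm (hψ : Continuous ψ) (hhol : HasHolomorphicCoords E ψ)
    (hΦd : MDifferentiable 𝓘(ℂ, E) 𝓘(ℂ, E) Φ) {k : Fin (2 + 2)} {ω₀ : MForm 𝓘(ℝ, E) M ℂ 2}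
    (hω₀ : ∀ x, ω₀ x = (show E [⋀^Fin 2]→L[ℝ] ℂ from
      (residueFormula (E := E) ψ (fermatPolynomial ℂ 2 m) 1 k k x).restrictScalars ℝ))
    {x : M} (hx : x ∈ liftDomain ψ k) :
    ω₀.pullback 𝓘(ℝ, E) Φ x = (∏ j, ((a j : ℂ) / (a k : ℂ))) • ω₀ x :=
  pullback_residueFormula_one_symm hΦ hψ hhol hΦd hx (normalVec_fermat_diag a k x) (hω₀ x)
    (hω₀ (Φ x))

/-- `ω_k y ≠ 0` as a form, for `y ∈ M_k` (it is non-zero on a frame). [cite: VoisinHodgeII2003, §6.1.3] -/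
theorem fermatVolumeForm_mform_ne_zero [NeZero m] (hψ : Topology.IsEmbedding ψ)
    (hrange : Set.range ψ = projZeroLocus {fermatPolynomial ℂ 2 m}) (hhol : HasHolomorphicCoords E ψ)
    (h2 : Module.finrank ℂ E = 2) {e : Fin 2 → E} (he : LinearIndependent ℂ e) {k : Fin (2 + 2)}
    {ω₀ : MForm 𝓘(ℝ, E) M ℂ 2}
    (hω₀ : ∀ x, ω₀ x = (show E [⋀^Fin 2]→L[ℝ] ℂ from
      (residueFormula (E := E) ψ (fermatPolynomial ℂ 2 m) 1 k k x).restrictScalars ℝ))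
    {y : M} (hy : y ∈ liftDomain ψ k) : ω₀ y ≠ 0 := by
  intro h0
  have h1 : (ω₀ y : E [⋀^Fin 2]→L[ℝ] ℂ) e = 0 := by rw [h0]; rfl
  rw [hω₀ y] at h1
  exact fermatVolumeForm_apply_ne_zero hψ hrange hhol h2 he hy h1

include hΦ in
/-- **The ratio function of an eigenform**: if `Φ^*η = χ • η`, then on `M_k`
`f_k(Φ x) · ∏_j (a_j/a_k) = χ · f_k(x)` (`ratio_symm` on the `Φ`-stable set `M_k`). In print:
`η = f_k ω_k` and `ω_k` has character `∏ a_j/a_k`, so `f_k` has the quotient character.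
[cite: Shioda1979HodgeFermat, §1 (1.7)] -/
theorem fermatRatio_symm [NeZero m] (hψ : Topology.IsEmbedding ψ)
    (hrange : Set.range ψ = projZeroLocus {fermatPolynomial ℂ 2 m}) (hhol : HasHolomorphicCoords E ψ)
    (h2 : Module.finrank ℂ E = 2) (hΦd : MDifferentiable 𝓘(ℂ, E) 𝓘(ℂ, E) Φ) {e : Fin 2 → E}
    (he : LinearIndependent ℂ e) {η : MForm 𝓘(ℝ, E) M ℂ 2} (ht : IsOfType 2 0 η) {χ : ℂ}
    (hχ : η.pullback 𝓘(ℝ, E) Φ = χ • η) {k : Fin (2 + 2)} {ω₀ : MForm 𝓘(ℝ, E) M ℂ 2}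
    (hω₀ : ∀ x, ω₀ x = (show E [⋀^Fin 2]→L[ℝ] ℂ from
      (residueFormula (E := E) ψ (fermatPolynomial ℂ 2 m) 1 k k x).restrictScalars ℝ))
    {f : M → ℂ} (hf : ∀ x, f x = η x e / ω₀ x e) {x : M} (hx : x ∈ liftDomain ψ k) :
    f (Φ x) * ∏ j, ((a j : ℂ) / (a k : ℂ)) = χ * f x :=
  ratio_symm (S := liftDomain ψ k) (fun _ hy ↦ mem_liftDomain_symm hΦ hy)
    (fun _ hy ↦ eq_fermatRatio_smul hψ hrange hhol h2 he ht hω₀ hf hy)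
    (fun _ hy ↦ fermatVolumeForm_mform_ne_zero hψ hrange hhol h2 he hω₀ hy)
    (fun y _ ↦ by rw [hχ]; rfl)
    (fun _ hy ↦ pullback_fermatVolumeForm hΦ hψ.continuous hhol hΦd hω₀ hy) hx

/-! ### Transition between the affine pieces `M₀` and `M₁` -/

omit [FiniteDimensional ℂ E] [IsManifold 𝓘(ℂ, E) ω M] in
/-- **The ratio functions on `M₀ ∩ M₁`: `f₀(x) · (x₀/x₁)^{m-4} = f₁(x)`.** From
`ω₀ = (x₀/x₁)^{m-4} • ω₁` on the overlap (`residueFormula_one_eq_zpow_smul` between the chart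
indices `0, 1` at normal index `0`, and `residueFormula_eq_of_jdx` between the normal indices
`0, 1`, both admissible there), with `x₀/x₁ = (Z̃₁ x)₀`. In print: the cocycle of
`K_X = 𝒪_X(m − 4)` (Hartshorne II 8.20.3) read on the local generators `Res_{Uᵢ}(Ω/F₀)`.
[cite: Hartshorne1977, II Example 8.20.3] [cite: VoisinHodgeII2003, §6.1.3] -/
theorem fermatRatio_zero_mul_zpow_eq_one [NeZero m] (hψ : Continuous ψ)
    (hrange : Set.range ψ = projZeroLocus {fermatPolynomial ℂ 2 m}) (hhol : HasHolomorphicCoords E ψ)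
    (e : Fin 2 → E) {η ω₀ ω₁ : MForm 𝓘(ℝ, E) M ℂ 2}
    (hω₀ : ∀ x, ω₀ x = (show E [⋀^Fin 2]→L[ℝ] ℂ from
      (residueFormula (E := E) ψ (fermatPolynomial ℂ 2 m) 1 0 0 x).restrictScalars ℝ))
    (hω₁ : ∀ x, ω₁ x = (show E [⋀^Fin 2]→L[ℝ] ℂ from
      (residueFormula (E := E) ψ (fermatPolynomial ℂ 2 m) 1 1 1 x).restrictScalars ℝ))
    {f₀ f₁ : M → ℂ} (hf₀ : ∀ x, f₀ x = η x e / ω₀ x e) (hf₁ : ∀ x, f₁ x = η x e / ω₁ x e)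
    {x : M} (hx₀ : x ∈ liftDomain ψ 0) (hx₁ : x ∈ liftDomain ψ 1) :
    f₀ x * (projLift ψ 1 x 0) ^ ((m : ℤ) - 4) = f₁ x := by
  set w : ℂ := projLift ψ 1 x 0 with hw
  have hF := isHomogeneous_fermatPolynomial (k := ℂ) 2 m
  -- `w ≠ 0` on the overlap
  have hw0 : w ≠ 0 := by
    intro h0
    have := projLift_eq_smul_of_mem ψ hx₁ hx₀
    rw [← hw, h0, inv_zero, zero_smul] at this
    exact projLift_ne_zero ψ 0 x this
  -- chart index `0 → 1` at normal index `0`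
  have h01 := residueFormula_one_eq_zpow_smul ψ hF NeZero.one_le hψ hhol (i := 1) (i' := 0)
    (j := 0) hx₁ hx₀
  -- normal index `0 → 1` at chart index `1`
  have hj0 : MvPolynomial.eval (projLift ψ 1 x) (MvPolynomial.pderiv 0 (fermatPolynomial ℂ 2 m)) ≠ 0 := by
    rw [eval_pderiv_fermatPolynomial]
    exact mul_ne_zero (Nat.cast_ne_zero.mpr (NeZero.ne m)) (pow_ne_zero _ hw0)
  have hjdx := residueFormula_eq_of_jdx ψ hF hψ hrange.le hhol 1 hx₁ hj0
    (eval_pderiv_fermatPolynomial_projLift_self_ne_zero ψ 1 x)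
  rw [hjdx] at h01
  -- evaluate on the frame
  have hexp : ((m : ℤ) - ((2 + 2 : ℕ) : ℤ)) = (m : ℤ) - 4 := by norm_num
  have key : (ω₀ x : E [⋀^Fin 2]→L[ℝ] ℂ) e = w ^ ((m : ℤ) - 4) * (ω₁ x : E [⋀^Fin 2]→L[ℝ] ℂ) e := by
    rw [hω₀ x, hω₁ x]
    change (residueFormula (E := E) ψ (fermatPolynomial ℂ 2 m) 1 0 0 x) e =
      w ^ ((m : ℤ) - 4) * (residueFormula (E := E) ψ (fermatPolynomial ℂ 2 m) 1 1 1 x) e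
    rw [h01, ContinuousAlternatingMap.smul_apply, smul_eq_mul, hexp]
  rw [hf₀ x, hf₁ x]
  change (η x : E [⋀^Fin 2]→L[ℝ] ℂ) e / (ω₀ x : E [⋀^Fin 2]→L[ℝ] ℂ) e * w ^ ((m : ℤ) - 4) =
    (η x : E [⋀^Fin 2]→L[ℝ] ℂ) e / (ω₁ x : E [⋀^Fin 2]→L[ℝ] ℂ) e
  rw [key]
  have hwk : w ^ ((m : ℤ) - 4) ≠ 0 := zpow_ne_zero _ hw0
  by_cases h1 : (ω₁ x : E [⋀^Fin 2]→L[ℝ] ℂ) e = 0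
  · rw [h1, mul_zero, div_zero, zero_mul]
  · field_simp

end Surface

end Literature.AlgebraicGeometry.HodgeTheory

end
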